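import Mathlib.Analysis.SpecialFunctions.Complex.Log
import Mathlib.LinearAlgebra.LinearIndependent.Basic
import HarnessLib

/-!
# Linear independence of the characters of the torus `𝕋ᵈ = ℝᵈ/ℤᵈ`

Topic `Literature/Analysis/Fourier`. Everything here is PROVED (no named facts, no definitions).

**The theorem** (`eq_zero_of_forall_sum_mul_cexp_eq_zero`). Let `q₁, …, qₙ ∈ ℝᵈ` be finitely
many points which are pairwise distinct modulo `ℤᵈ` (for `i ≠ j` some coordinate difference
`qᵢₗ - qⱼₗ` is not an integer), and let `c₁, …, cₙ ∈ ℂ`. If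
`∑ⱼ cⱼ · e^{2πi ⟨k, qⱼ⟩} = 0` for every `k ∈ ℤᵈ`, then every `cⱼ` vanishes.

Equivalently: the finitely supported complex measure `μ = ∑ⱼ cⱼ δ_{qⱼ}` on the torus `𝕋ᵈ` is
determined by its Fourier–Stieltjes coefficients `μ̂(k) = ∑ⱼ cⱼ e^{-2πi⟨k,qⱼ⟩}` (uniqueness
theorem, Katznelson Ch. I §7, here in the elementary finitely-supported case, in any dimension);
or again: the characters `k ↦ e^{2πi⟨k,x⟩}` of `ℤᵈ` attached to distinct points `x ∈ 𝕋ᵈ` are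
linearly independent over `ℂ` (Artin's / Dedekind's theorem on the independence of characters,
Lang Ch. VI §4).

**Proof outline** (Artin–Dedekind route, all in Mathlib).
1. For `x ∈ ℝᵈ` the map `k ↦ e^{2πi ∑ₗ kₗ xₗ}` is a monoid homomorphism
   `Multiplicative (Fin d → ℤ) →* ℂ` (`exists_monoidHom_apply_eq_cexp`; `Complex.exp_add`).
2. Distinct points mod `ℤᵈ` give distinct homomorphisms (`q i ≠ q j mod ℤᵈ`): evaluating at the
   basis vector `k = eₗ` gives `e^{2πi qᵢₗ} = e^{2πi qⱼₗ}`, and `Complex.exp_eq_exp_iff_exists_int`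
   forces `qᵢₗ - qⱼₗ ∈ ℤ`.
3. Dedekind's independence of characters (`linearIndependent_monoidHom`) transported along the
   injective family of step 2 (`LinearIndependent.comp`); the hypothesis says precisely that the
   linear combination `∑ⱼ cⱼ χⱼ` is the zero function on `ℤᵈ`, so `Fintype.linearIndependent_iff`
   concludes.

What is NOT here: the measure-theoretic uniqueness theorem for arbitrary finite Borel measures on
`𝕋ᵈ` (Fejér summability), and any statement about infinite point configurations.

## References

* Y. Katznelson, *An Introduction to Harmonic Analysis*, 3rd ed., Cambridge University Press
  (2004), Ch. I §7 (Fourier–Stieltjes coefficients of measures on `𝕋`; uniqueness theorem: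
  a measure with all Fourier–Stieltjes coefficients zero is zero).
* S. Lang, *Algebra*, revised 3rd ed., Springer GTM 211 (2002), Ch. VI §4, Theorem 4.1
  (Artin: distinct characters of a monoid into a field are linearly independent). [folklore]
-/

namespace Literature.Analysis.Fourier

/-- **The characters of `ℤᵈ`.** For a frequency vector `x ∈ ℝᵈ`, the map
`k ↦ exp (2πi ∑ₗ kₗ xₗ)` is a monoid homomorphism `Multiplicative (Fin d → ℤ) →* ℂ`
(additivity of the exponent and `exp (a + b) = exp a · exp b`). Stated as an existence so that
no auxiliary definition is introduced. [folklore] -/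
theorem exists_monoidHom_apply_eq_cexp {d : ℕ} (x : Fin d → ℝ) :
    ∃ χ : Multiplicative (Fin d → ℤ) →* ℂ, ∀ k : Fin d → ℤ,
      χ (Multiplicative.ofAdd k) =
        Complex.exp (2 * Real.pi * Complex.I * ∑ l : Fin d, (k l : ℂ) * (x l : ℂ)) := by
  refine ⟨{ toFun := fun k => Complex.exp (2 * Real.pi * Complex.I *
              ∑ l : Fin d, ((Multiplicative.toAdd k l : ℤ) : ℂ) * (x l : ℂ)),
            map_one' := ?_, map_mul' := ?_ }, fun k => rfl⟩
  · simp
  · intro k k'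
    rw [← Complex.exp_add, ← mul_add, ← Finset.sum_add_distrib]
    congr 2
    refine Finset.sum_congr rfl fun l _ => ?_
    rw [toAdd_mul, Pi.add_apply, Int.cast_add, add_mul]

/-- **Linear independence of torus characters / uniqueness of Fourier coefficients of finitely
supported measures on `𝕋ᵈ`.** Let `q : Fin n → ℝᵈ` be points pairwise distinct modulo `ℤᵈ`
(`hq`: for `i ≠ j` some coordinate difference `q i l - q j l` is not an integer) and
`c : Fin n → ℂ`. If `∑ⱼ c j · exp (2πi ⟨k, q j⟩) = 0` for every `k ∈ ℤᵈ`, then `c = 0`.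
(Katznelson, Ch. I §7, uniqueness theorem, finitely supported case; equivalently Artin's theorem
on the independence of the characters `k ↦ e^{2πi⟨k, qⱼ⟩}` of `ℤᵈ`, Lang, *Algebra*, VI §4.)
[folklore] -/
theorem eq_zero_of_forall_sum_mul_cexp_eq_zero {d n : ℕ} (q : Fin n → Fin d → ℝ) (c : Fin n → ℂ)
    (hq : ∀ i j : Fin n, i ≠ j → ∃ l : Fin d, ¬ ∃ m : ℤ, q i l - q j l = m)
    (h : ∀ k : Fin d → ℤ,
      ∑ j : Fin n, c j *
        Complex.exp (2 * Real.pi * Complex.I * ∑ l : Fin d, (k l : ℂ) * (q j l : ℂ)) = 0) :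
    ∀ j : Fin n, c j = 0 := by
  -- Step 1: the characters `χ j : k ↦ e^{2πi⟨k, q j⟩}` as monoid homomorphisms of `ℤᵈ`.
  choose χ hχ using fun j : Fin n => exists_monoidHom_apply_eq_cexp (q j)
  -- Step 2: distinct points modulo `ℤᵈ` give distinct characters.
  have hinj : Function.Injective χ := by
    intro i j hij
    by_contra hne
    obtain ⟨l, hl⟩ := hq i j hne
    apply hl
    have hev := congrArg
      (fun f : Multiplicative (Fin d → ℤ) →* ℂ => f (Multiplicative.ofAdd (Pi.single l 1))) hij
    simp only [hχ, Pi.single_apply, Int.cast_ite, Int.cast_one, Int.cast_zero, ite_mul, one_mul,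
      zero_mul, Finset.sum_ite_eq', Finset.mem_univ, if_true] at hev
    obtain ⟨m, hm⟩ := Complex.exp_eq_exp_iff_exists_int.mp hev
    refine ⟨m, ?_⟩
    have h2 : (2 * Real.pi * Complex.I : ℂ) ≠ 0 := by simp [Real.pi_ne_zero, Complex.I_ne_zero]
    have h3 : (2 * Real.pi * Complex.I) * ((q i l - q j l : ℝ) : ℂ) =
        (2 * Real.pi * Complex.I) * ((m : ℝ) : ℂ) := by
      push_cast
      linear_combination hm
    exact_mod_cast mul_left_cancel₀ h2 h3
  -- Step 3: Dedekind's independence of characters, transported along the injective family `χ`.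
  have hli : LinearIndependent ℂ (fun j : Fin n =>
      ((χ j : Multiplicative (Fin d → ℤ) →* ℂ) : Multiplicative (Fin d → ℤ) → ℂ)) :=
    (linearIndependent_monoidHom (Multiplicative (Fin d → ℤ)) ℂ).comp χ hinj
  have hsum : ∑ j : Fin n, c j • ((χ j : Multiplicative (Fin d → ℤ) →* ℂ) :
      Multiplicative (Fin d → ℤ) → ℂ) = 0 := by
    funext k'
    obtain ⟨k, rfl⟩ : ∃ k : Fin d → ℤ, Multiplicative.ofAdd k = k' := ⟨Multiplicative.toAdd k', rfl⟩
    simpa only [Finset.sum_apply, Pi.smul_apply, smul_eq_mul, Pi.zero_apply, hχ] using h k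
  exact Fintype.linearIndependent_iff.mp hli c hsum

end Literature.Analysis.Fourier
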